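import Summits.Ventures.PercRepro.LemmaBPlusK5Def

/-!
# Faces of `K₅`: kernel slices 12 … 15 (part D)

Each theorem is one `decide +kernel` at default heartbeats (≈ 55 s: the 1024-row table of the marking
plus ≤ 22 000 face points in sub-mask loops); generated by `tools/gen_k5.py`.
-/

namespace PercRepro

namespace Examples

open MultiGraph

/-- Slice 12: joins `u ∈ [511, 542)` of the faces of `K₅` (21783 face points). -/
theorem k5_slice_12 : k5.FacesSRange ![0, 1, 2, 3] 511 542 := by decide +kernel

/-- Slice 13: joins `u ∈ [542, 619)` of the faces of `K₅` (21699 face points). -/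
theorem k5_slice_13 : k5.FacesSRange ![0, 1, 2, 3] 542 619 := by decide +kernel

/-- Slice 14: joins `u ∈ [619, 639)` of the faces of `K₅` (18792 face points). -/
theorem k5_slice_14 : k5.FacesSRange ![0, 1, 2, 3] 619 639 := by decide +kernel

/-- Slice 15: joins `u ∈ [639, 687)` of the faces of `K₅` (20502 face points). -/
theorem k5_slice_15 : k5.FacesSRange ![0, 1, 2, 3] 639 687 := by decide +kernel

end Examples

end PercRepro
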